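import Literature.NumberTheory.Transcendental.KZLogCalculusProofs
import Literature.NumberTheory.Transcendental.KZDominatedFamilyRelations
import Literature.NumberTheory.Transcendental.KZSemiCanonicalReductionProofs
import Literature.NumberTheory.Transcendental.SemialgebraicLineDeriv
import Summits.KontsevichZagierPeriods.KontsevichZagierPeriods.Theorems.LogKernelConjecture.Negative.Torsion

/-!
# Cellwise fold for `LogPrimitiveNL` (line `logderiv-peeling`), part 1: power and peeling rules

Support lemmas for the stub `stub_cellwiseFold` of crux `LogPrimitiveNL`
(stmt-KontsevichZagierPeriods-2836), all inside the honest four-move Kontsevich–Zagier calculus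
`KZ.relations` and with every intermediate representation absolutely integrable:

* `fold_exists_unfoldRep` — the honest unfolded monomial `[{x ∈ P, 1 ≤ u ≤ v x}, g x/u]`
  exists as a `KZ.IntegralRep` as soon as `g`, `v ≥ 1` are `ℚ`-semialgebraic on `P` and
  `g log v ∈ L¹(P)` (Tonelli, `KZlog.integrableOn_band_of_lintegral_fibre_le`);
* `fold_of_sub_of_sub_mem_relations_mul_pow` — the unfolded power rule with multiplicity
  `[{1 ≤ t ≤ u wᵉ}, g/t] − [{1 ≤ t ≤ u}, g/t] − [{1 ≤ s ≤ w}, e g/s] ∈ relations`, by induction on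
  `e` from the tree's unfolded product rule `KZ.of_sub_of_sub_mem_relations_mul`;
* `fold_of_sub_sum_mem_relations_peel` (closed form `fold_peel`, the registered support lemma) —
  peeling a monomial `∏ₗ Mₗ ^ eₗ` (`Mₗ ≥ 1`) factor by factor:
  `[{1 ≤ t ≤ ∏ₗ Mₗ^{eₗ}}, g/t] − Σₗ [{1 ≤ s ≤ Mₗ}, eₗ g/s] ∈ relations`.

No new definitions; nothing here is specific to the crux.
-/

noncomputable section

open Set MeasureTheory
open Literature.NumberTheory.Transcendental Literature.ModelTheory.ExponentialFields

namespace Summit.KontsevichZagierPeriods.LiouvilleUnfolding.LogPrimitiveNL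


/-- Bands only depend on the values of the upper edge on the base. -/
theorem fold_band_congr_right {n : ℕ} {τ : Set (Fin n → ℝ)} {a b b' : (Fin n → ℝ) → ℝ}
    (h : ∀ x ∈ τ, b x = b' x) : KZlog.band τ a b = KZlog.band τ a b' := by
  ext z
  simp only [KZlog.band, mem_setOf_eq]
  exact ⟨fun ⟨h1, h2, h3⟩ => ⟨h1, h2, by rwa [← h _ h1]⟩,
    fun ⟨h1, h2, h3⟩ => ⟨h1, h2, by rwa [h _ h1]⟩⟩

/-- The constant function `1` is `ℚ`-semialgebraic on a `ℚ`-semialgebraic set. -/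
theorem fold_isSemialgebraicFunOn_one {n : ℕ} {P : Set (Fin n → ℝ)} (hP : IsSemialgebraic ℚ P) :
    IsSemialgebraicFunOn ℚ P (fun _ => (1 : ℝ)) := by
  simpa using isSemialgebraicFunOn_ratCast hP 1

/-- Integer powers of a real `ℚ`-semialgebraic function are semialgebraic (Mathlib's junk value
`0⁻¹ = 0` included, via `IsSemialgebraicFunOn.fun_inv`). -/
theorem fold_fun_zpow {d : ℕ} {S : Set (Fin d → ℝ)} {f : (Fin d → ℝ) → ℝ}
    (hf : IsSemialgebraicFunOn ℚ S f) (z : ℤ) : IsSemialgebraicFunOn ℚ S fun x => f x ^ z := by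
  obtain ⟨n, rfl | rfl⟩ := z.eq_nat_or_neg
  · simpa using hf.fun_pow n
  · simpa using (hf.fun_pow n).fun_inv

/-- **The honest unfolded monomial.** For `g` and `v ≥ 1` `ℚ`-semialgebraic on a `ℚ`-semialgebraic
`P` with `g log v ∈ L¹(P)`, `[{(x, u) | x ∈ P, 1 ≤ u ≤ v x}, g x/u]` is a `KZ.IntegralRep`: its
domain is a band (Tarski–Seidenberg), its integrand is semialgebraic, and it is absolutely
integrable by Tonelli, the fibre integral of `|g x|/u` over `[1, v x]` being `|g x| log v x`
(`KZlog.integrableOn_band_of_lintegral_fibre_le`, `KZlog.lintegral_enorm_div_Icc_one`). -/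
theorem fold_exists_unfoldRep {n : ℕ} {P : Set (Fin n → ℝ)} (hP : IsSemialgebraic ℚ P)
    {g v : (Fin n → ℝ) → ℝ} (hg : IsSemialgebraicFunOn ℚ P g) (hv : IsSemialgebraicFunOn ℚ P v)
    (hv1 : ∀ x ∈ P, 1 ≤ v x) (hint : IntegrableOn (fun x => g x * Real.log (v x)) P) :
    ∃ R : KZ.IntegralRep (n + 1), R.domain = KZlog.band P (fun _ => 1) v ∧
      R.integrand = fun z => g (Fin.init z) / z (Fin.last n) := by
  have hB : IsSemialgebraic ℚ (KZlog.band P (fun _ => 1) v) :=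
    KZlog.isSemialgebraic_band (fold_isSemialgebraicFunOn_one hP) hv
  have hBm : MeasurableSet (KZlog.band P (fun _ => 1) v) := IsSemialgebraic.measurableSet_holds hB
  have hPm : MeasurableSet P := IsSemialgebraic.measurableSet_holds hP
  have hsa : IsSemialgebraicFunOn ℚ (KZlog.band P (fun _ => 1) v)
      (fun z => g (Fin.init z) / z (Fin.last n)) := by
    have h1 : IsSemialgebraicFunOn ℚ (KZlog.band P (fun _ => 1) v) (fun z => g (Fin.init z)) :=
      hg.comp_init_mono hB KZ.band_subset_setOf_init_mem
    have h2 : IsSemialgebraicFunOn ℚ (KZlog.band P (fun _ => 1) v)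
        (fun z => 1 / z (Fin.last n)) :=
      (isSemialgebraicFunOn_aeval_div_aeval hB 1 (MvPolynomial.X (Fin.last n)) fun z hz => by
        simpa using (one_pos.trans_le hz.2.1).ne').congr fun z _ => by simp
    exact (h1.fun_mul h2).congr fun z _ => by simp [div_eq_mul_inv]
  refine ⟨⟨KZlog.band P (fun _ => 1) v, fun z => g (Fin.init z) / z (Fin.last n), hB, hsa, ?_⟩,
    rfl, rfl⟩
  refine KZlog.integrableOn_band_of_lintegral_fibre_le hPm hBm (fun x t => KZlog.snoc_mem_band)
    (KZ.aestronglyMeasurable_of_isSemialgebraicFunOn hsa hBm)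
    (K := fun x => g x * Real.log (v x)) (fun x hx => ?_) hint
  have : ∀ t : ℝ, g (Fin.init (Fin.snoc x t : Fin (n + 1) → ℝ)) /
      (Fin.snoc x t : Fin (n + 1) → ℝ) (Fin.last n) = g x / t := fun t => by simp
  simp_rw [this]
  exact (KZlog.lintegral_enorm_div_Icc_one _ _ (hv1 x hx)).le

/-- **The unfolded power rule with multiplicity.** For `u, w ≥ 1` `ℚ`-semialgebraic on a
`ℚ`-semialgebraic `σ`, any `g`, and `e : ℕ`: honest representations `R = [{1 ≤ t ≤ u wᵉ}, g/t]`,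
`R₁ = [{1 ≤ t ≤ u}, g/t]`, `R₂ = [{1 ≤ s ≤ w}, e·g/s]` satisfy `[R] − [R₁] − [R₂] ∈ relations`.
Induction on `e`: `u wᵉ⁺¹ = (u wᵉ) w` and the unfolded product rule
`KZ.of_sub_of_sub_mem_relations_mul`, the intermediate representation `[{1 ≤ t ≤ u wᵉ}, g/t]` being
the restriction of `R` (so it is honest), and `[{1 ≤ s ≤ w}, j·g/s]` the rescalings
`KZ.IntegralRep.constMul` of `R₂` (integrand additivity splits `(e+1) g = e g + g`). -/
theorem fold_of_sub_of_sub_mem_relations_mul_pow {m : ℕ} {σ : Set (Fin m → ℝ)}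
    {g u w : (Fin m → ℝ) → ℝ} (hσ : IsSemialgebraic ℚ σ) (hu : IsSemialgebraicFunOn ℚ σ u)
    (hw : IsSemialgebraicFunOn ℚ σ w) (hu1 : ∀ x ∈ σ, 1 ≤ u x) (hw1 : ∀ x ∈ σ, 1 ≤ w x) :
    ∀ (e : ℕ) (R R₁ R₂ : KZ.IntegralRep (m + 1)),
      R.domain = KZlog.band σ (fun _ => 1) (fun x => u x * w x ^ e) →
      EqOn R.integrand (fun z => g (Fin.init z) / z (Fin.last m)) R.domain →
      R₁.domain = KZlog.band σ (fun _ => 1) u →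
      EqOn R₁.integrand (fun z => g (Fin.init z) / z (Fin.last m)) R₁.domain →
      R₂.domain = KZlog.band σ (fun _ => 1) w →
      EqOn R₂.integrand (fun z => (e : ℝ) * g (Fin.init z) / z (Fin.last m)) R₂.domain →
      KZ.of R - KZ.of R₁ - KZ.of R₂ ∈ KZ.relations := by
  intro e
  induction e with
  | zero =>
    intro R R₁ R₂ hRd hRi hR₁d hR₁i hR₂d hR₂i
    have hdom : R₁.domain = R.domain := by
      rw [hR₁d, hRd]
      exact fold_band_congr_right fun x _ => by simp
    have h1 : KZ.of R - KZ.of R₁ ∈ KZ.relations :=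
      KZ.of_sub_of_mem_relations_of_eqOn hdom fun z hz => by
        rw [hRi hz, hR₁i (by rwa [hdom])]
    have h2 : KZ.of R₂ ∈ KZ.relations :=
      KZ.of_mem_relations_of_eqOn_zero R₂ fun z hz => by
        rw [hR₂i hz]
        simp
    exact KZ.relations.sub_mem h1 h2
  | succ e ih =>
    intro R R₁ R₂ hRd hRi hR₁d hR₁i hR₂d hR₂i
    have hU : IsSemialgebraicFunOn ℚ σ (fun x => u x * w x ^ e) := hu.fun_mul (hw.fun_pow e)
    have hU1 : ∀ x ∈ σ, 1 ≤ u x * w x ^ e := fun x hx =>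
      one_le_mul_of_one_le_of_one_le (hu1 x hx) (one_le_pow₀ (hw1 x hx))
    have hB : IsSemialgebraic ℚ (KZlog.band σ (fun _ => 1) (fun x => u x * w x ^ e)) :=
      KZlog.isSemialgebraic_band (fold_isSemialgebraicFunOn_one hσ) hU
    have hsub : KZlog.band σ (fun _ => 1) (fun x => u x * w x ^ e) ⊆ R.domain := by
      intro z hz
      rw [hRd]
      refine ⟨hz.1, hz.2.1, hz.2.2.trans ?_⟩
      exact mul_le_mul_of_nonneg_left (pow_le_pow_right₀ (hw1 _ hz.1) (Nat.le_succ e))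
        (zero_le_one.trans (hu1 _ hz.1))
    set R' := R.restrict _ hB hsub with hR'
    have hqa : IsAlgebraic ℚ (((e + 1 : ℕ) : ℝ)⁻¹) := (isAlgebraic_nat (e + 1)).inv
    set R₂'' := R₂.constMul _ hqa with hR₂''
    set R₂' := R₂''.constMul (e : ℝ) (isAlgebraic_nat e) with hR₂'
    -- the product rule `u w^{e+1} = (u w^e) · w`
    have hprod : KZ.of R - KZ.of R' - KZ.of R₂'' ∈ KZ.relations := by
      refine KZ.of_sub_of_sub_mem_relations_mul hσ hU hw hU1 hw1 R R' R₂'' ?_ hRi rfl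
        (fun z hz => hRi (hsub hz)) (by rw [hR₂'', KZ.IntegralRep.domain_constMul, hR₂d]) ?_
      · rw [hRd]
        exact fold_band_congr_right fun x _ => by ring
      · intro z hz
        rw [hR₂'', KZ.IntegralRep.domain_constMul] at hz
        simp only [hR₂'', KZ.IntegralRep.integrand_constMul]
        rw [hR₂i hz]
        push_cast
        field_simp
    -- the induction hypothesis for the restriction
    have hIH : KZ.of R' - KZ.of R₁ - KZ.of R₂' ∈ KZ.relations := by
      refine ih R' R₁ R₂' rfl (fun z hz => hRi (hsub hz)) hR₁d hR₁i
        (by rw [hR₂', KZ.IntegralRep.domain_constMul, hR₂'', KZ.IntegralRep.domain_constMul, hR₂d])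
        fun z hz => ?_
      rw [hR₂', KZ.IntegralRep.domain_constMul, hR₂'', KZ.IntegralRep.domain_constMul] at hz
      simp only [hR₂', hR₂'', KZ.IntegralRep.integrand_constMul]
      rw [hR₂i hz]
      push_cast
      field_simp
    -- integrand additivity `(e + 1) g = e g + g`
    have hadd : KZ.of R₂ - KZ.of R₂' - KZ.of R₂'' ∈ KZ.relations := by
      refine KZ.integrandAddRel_subset_relations
        ⟨m + 1, R₂, R₂', R₂'', rfl, rfl, fun z _ => ?_, rfl⟩
      simp only [hR₂', hR₂'', KZ.IntegralRep.integrand_constMul, Pi.add_apply]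
      push_cast
      field_simp
    have : KZ.of R - KZ.of R₁ - KZ.of R₂ = (KZ.of R - KZ.of R' - KZ.of R₂'') +
        (KZ.of R' - KZ.of R₁ - KZ.of R₂') - (KZ.of R₂ - KZ.of R₂' - KZ.of R₂'') := by abel
    rw [this]
    exact KZ.relations.sub_mem (KZ.relations.add_mem hprod hIH) hadd

/-- **Peeling an unfolded monomial factor by factor.** For `ℚ`-semialgebraic `Mₗ ≥ 1` (`l < p`) on a
`ℚ`-semialgebraic `σ`, exponents `eₗ : ℕ`, any `g`, an honest `R = [{1 ≤ t ≤ ∏ₗ Mₗ^{eₗ}}, g/t]` and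
honest `Tₗ = [{1 ≤ s ≤ Mₗ}, eₗ·g/s]`: `[R] − Σₗ [Tₗ] ∈ relations`. Induction on `p` with the power
rule `fold_of_sub_of_sub_mem_relations_mul_pow`; every intermediate representation
`[{1 ≤ t ≤ ∏_{l < q} Mₗ^{eₗ}}, g/t]` is a restriction of `R` (all factors are `≥ 1`), hence honest;
for `p = 0` the band `{1 ≤ t ≤ 1}` is null. -/
theorem fold_of_sub_sum_mem_relations_peel {m : ℕ} {σ : Set (Fin m → ℝ)}
    (hσ : IsSemialgebraic ℚ σ) {g : (Fin m → ℝ) → ℝ} :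
    ∀ (p : ℕ) (M : Fin p → (Fin m → ℝ) → ℝ) (e : Fin p → ℕ),
      (∀ l, IsSemialgebraicFunOn ℚ σ (M l)) → (∀ l, ∀ x ∈ σ, 1 ≤ M l x) →
      ∀ (R : KZ.IntegralRep (m + 1)) (T : Fin p → KZ.IntegralRep (m + 1)),
      R.domain = KZlog.band σ (fun _ => 1) (fun x => ∏ l, M l x ^ e l) →
      EqOn R.integrand (fun z => g (Fin.init z) / z (Fin.last m)) R.domain →
      (∀ l, (T l).domain = KZlog.band σ (fun _ => 1) (M l)) →
      (∀ l, EqOn (T l).integrand (fun z => (e l : ℝ) * g (Fin.init z) / z (Fin.last m))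
        (T l).domain) →
      KZ.of R - ∑ l, KZ.of (T l) ∈ KZ.relations := by
  intro p
  induction p with
  | zero =>
    intro M e _ _ R T hRd _ _ _
    simp only [Finset.univ_eq_empty, Finset.sum_empty, sub_zero]
    refine KZ.of_mem_relations_of_volume_eq_zero R
      (measure_mono_null (fun z hz => ?_) (KZ.volume_setOf_last_eq_zero (n := m) 1))
    rw [hRd] at hz
    simp only [KZlog.band, Finset.univ_eq_empty, Finset.prod_empty, mem_setOf_eq] at hz
    exact le_antisymm hz.2.2 hz.2.1
  | succ p ih =>
    intro M e hM hM1 R T hRd hRi hTd hTi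
    set u : (Fin m → ℝ) → ℝ := fun x => ∏ l : Fin p, M (Fin.castSucc l) x ^ e (Fin.castSucc l)
      with hu_def
    have hu : IsSemialgebraicFunOn ℚ σ u :=
      IsSemialgebraicFunOn.fun_finsetProd _ hσ fun l _ => (hM _).fun_pow _
    have hu1 : ∀ x ∈ σ, 1 ≤ u x := fun x hx =>
      Finset.one_le_prod fun l _ => one_le_pow₀ (hM1 _ x hx)
    have hRd' : R.domain =
        KZlog.band σ (fun _ => 1) (fun x => u x * M (Fin.last p) x ^ e (Fin.last p)) := by
      rw [hRd]
      exact fold_band_congr_right fun x _ => Fin.prod_univ_castSucc _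
    have hB : IsSemialgebraic ℚ (KZlog.band σ (fun _ => 1) u) :=
      KZlog.isSemialgebraic_band (fold_isSemialgebraicFunOn_one hσ) hu
    have hsub : KZlog.band σ (fun _ => 1) u ⊆ R.domain := by
      intro z hz
      rw [hRd']
      exact ⟨hz.1, hz.2.1, hz.2.2.trans (le_mul_of_one_le_right (zero_le_one.trans (hu1 _ hz.1))
        (one_le_pow₀ (hM1 _ _ hz.1)))⟩
    set R' := R.restrict _ hB hsub with hR'
    have h1 : KZ.of R - KZ.of R' - KZ.of (T (Fin.last p)) ∈ KZ.relations :=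
      fold_of_sub_of_sub_mem_relations_mul_pow hσ hu (hM _) hu1 (hM1 _) (e (Fin.last p)) R R'
        (T (Fin.last p)) hRd' hRi rfl (fun z hz => hRi (hsub hz)) (hTd _) (hTi _)
    have h2 : KZ.of R' - ∑ l : Fin p, KZ.of (T (Fin.castSucc l)) ∈ KZ.relations :=
      ih (fun l => M (Fin.castSucc l)) (fun l => e (Fin.castSucc l)) (fun l => hM _)
        (fun l => hM1 _) R' (fun l => T (Fin.castSucc l)) rfl (fun z hz => hRi (hsub hz))
        (fun l => hTd _) (fun l => hTi _)
    rw [Fin.sum_univ_castSucc]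
    have : KZ.of R - (∑ l : Fin p, KZ.of (T (Fin.castSucc l)) + KZ.of (T (Fin.last p))) =
        (KZ.of R - KZ.of R' - KZ.of (T (Fin.last p))) +
          (KZ.of R' - ∑ l : Fin p, KZ.of (T (Fin.castSucc l))) := by abel
    rw [this]
    exact KZ.relations.add_mem h1 h2


/-- **Peeling, closed form** (the registered support lemma of this file; `∀`-form of
`fold_of_sub_sum_mem_relations_peel`): for `ℚ`-semialgebraic `Mₗ ≥ 1` on a `ℚ`-semialgebraic `σ`,
exponents `eₗ`, any `g`, honest `R = [{1 ≤ t ≤ ∏ₗ Mₗ^{eₗ}}, g/t]` and `Tₗ = [{1 ≤ s ≤ Mₗ}, eₗ g/s]`: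
`[R] − Σₗ [Tₗ] ∈ KZ.relations`. -/
theorem fold_peel :
    ∀ (m : ℕ) (σ : Set (Fin m → ℝ)) (g : (Fin m → ℝ) → ℝ) (p : ℕ) (M : Fin p → (Fin m → ℝ) → ℝ)
      (e : Fin p → ℕ) (R : KZ.IntegralRep (m + 1)) (T : Fin p → KZ.IntegralRep (m + 1)),
      IsSemialgebraic ℚ σ → (∀ l, IsSemialgebraicFunOn ℚ σ (M l)) → (∀ l, ∀ x ∈ σ, 1 ≤ M l x) →
      R.domain = KZlog.band σ (fun _ => 1) (fun x => ∏ l, M l x ^ e l) →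
      EqOn R.integrand (fun z => g (Fin.init z) / z (Fin.last m)) R.domain →
      (∀ l, (T l).domain = KZlog.band σ (fun _ => 1) (M l)) →
      (∀ l, EqOn (T l).integrand (fun z => (e l : ℝ) * g (Fin.init z) / z (Fin.last m))
        (T l).domain) →
      KZ.of R - ∑ l, KZ.of (T l) ∈ KZ.relations :=
  fun _ _ _ p M e R T hσ hM hM1 hRd hRi hTd hTi =>
    fold_of_sub_sum_mem_relations_peel hσ p M e hM hM1 R T hRd hRi hTd hTi

end Summit.KontsevichZagierPeriods.LiouvilleUnfolding.LogPrimitiveNL
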